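import Literature.AlgebraicGeometry.Resolution.SyzygyStaircase
import Mathlib.RingTheory.Regular.RegularSequence
import Mathlib.RingTheory.Ideal.Quotient.Basic
import Mathlib.Algebra.BigOperators.Pi
import HarnessLib

/-!
# From the staircase lemma to annihilators of parameter colon modules

Topic: `Literature/AlgebraicGeometry/Resolution` (the mechanism of [BrunsHerzog1998, Thm. 8.1.2
and Cor. 8.1.3 (b)] / [Schenzel1982, Satz 2.4.2], Ext-annihilator form; used for the existence of
Kawasaki's `p`-standard / Česnavičius's CM-secant systems of parameters behind Macaulayfication).

Let `F` be a free resolution of finite type of the `R`-module `M` (`FreeResolution R M`), with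
syzygy tower `K_q = F.syzygyObj q`, `F_q = F.coverObj q` and dual cohomology modules
`E^q = K_q^*/B^q = F.EMod q` (`E^q ≅ Ext^q(M, R)`; `SyzygyStaircase.lean`), and let `𝔵 ⊆ R` be an
ideal. If ideals `𝔞 1, 𝔞 2, …` satisfy the staircase hypothesis for
`Q = R/𝔵` — for each `q ≥ 1` either `𝔞 q · E^q = 0` or `Ext^{q-1}_R(E^q, R/𝔵) = 0` — then:

* `smul_mem_smul_top_syzygy_of_mem` (**"`𝔞 1 ⋯ 𝔞 n` kills `Tor₁(R/𝔵, M)`"**): for `y ∈ K₁` with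
  `j₀(y) ∈ 𝔵F₀` and `c ∈ 𝔞 1 ⋯ 𝔞 n`, `c y ∈ 𝔵K₁`. (The class of `y` in
  `(K₁ ∩ 𝔵F₀)/𝔵K₁ = Tor₁(R/𝔵, M)` corresponds to a `1`-cycle of `Hom(F^*, R/𝔵) ≅ F ⊗ R/𝔵`, to
  which the staircase lemma `StaircaseData.exists_factor_of_mem_prod` applies.)
* `smul_mem_of_getElem_smul_mem` (**the colon statement**, [BrunsHerzog1998, Cor. 8.1.3 (b)] in
  Ext form): if moreover `𝔵 = (x₁, …, x_{i+1})` for a sequence `x` that is weakly regular on `R`,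
  then `c · ((x₁,…,xᵢ)M :_M x_{i+1}) ⊆ (x₁,…,xᵢ)M` for every `c ∈ 𝔞 1 ⋯ 𝔞 n`.

[cite: BrunsHerzog1998, Thm. 8.1.2, Cor. 8.1.3 (b); Schenzel1982, Satz 2.4.2]
-/

noncomputable section

open CategoryTheory CategoryTheory.Abelian CategoryTheory.Limits Module
open RingTheory.Sequence

universe u

namespace Literature.AlgebraicGeometry.Resolution

/-! ## Linear algebra on `Rᵏ`: ideal multiples -/

section Pi

variable {R : Type u} [CommRing R] {k : ℕ}

/-- `v ∈ I · Rᵏ` iff all coordinates of `v` lie in `I`. [folklore] -/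
theorem mem_ideal_smul_top_pi_iff (I : Ideal R) (v : Fin k → R) :
    v ∈ I • (⊤ : Submodule R (Fin k → R)) ↔ ∀ j, v j ∈ I := by
  constructor
  · intro hv j
    refine Submodule.smul_induction_on (p := fun v => v j ∈ I) hv (fun r hr w _ => ?_)
      (fun v w hv hw => ?_)
    · rw [Pi.smul_apply, smul_eq_mul]
      exact I.mul_mem_right _ hr
    · rw [Pi.add_apply]
      exact I.add_mem hv hw
  · intro hv
    rw [← Finset.univ_sum_single v]
    refine Submodule.sum_mem _ fun j _ => ?_
    have : (Pi.single j (v j) : Fin k → R) = v j • Pi.single j (1 : R) := by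
      ext l
      by_cases h : l = j
      · subst h; simp
      · simp [Pi.single_eq_of_ne h]
    rw [this]
    exact Submodule.smul_mem_smul (hv j) Submodule.mem_top

/-- A linear form maps `I · Rᵏ` into `I`. [folklore] -/
theorem dual_apply_mem_of_mem_ideal_smul_top (I : Ideal R) {v : Fin k → R}
    (hv : v ∈ I • (⊤ : Submodule R (Fin k → R))) (φ : Dual R (Fin k → R)) : φ v ∈ I := by
  refine Submodule.smul_induction_on (p := fun v => φ v ∈ I) hv (fun r hr w _ => ?_)
    (fun v w hv hw => ?_)
  · rw [map_smul, smul_eq_mul]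
    exact I.mul_mem_right _ hr
  · rw [map_add]
    exact I.add_mem hv hw

/-- If every linear form takes `v` into `I` then `v ∈ I · Rᵏ`. [folklore] -/
theorem mem_ideal_smul_top_of_forall_dual (I : Ideal R) {v : Fin k → R}
    (hv : ∀ φ : Dual R (Fin k → R), φ v ∈ I) : v ∈ I • (⊤ : Submodule R (Fin k → R)) := by
  rw [mem_ideal_smul_top_pi_iff]
  intro j
  simpa using hv (LinearMap.proj j)

/-- Every linear map `(Rᵏ)^* → R/I` is `ψ ↦ ψ(g) mod I` for some `g ∈ Rᵏ`
(`Hom((Rᵏ)^*, R/I) ≅ Rᵏ ⊗ R/I`). [folklore] -/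
theorem exists_dual_to_quotient_repr (I : Ideal R) (w : Dual R (Fin k → R) →ₗ[R] R ⧸ I) :
    ∃ g : Fin k → R, ∀ ψ : Dual R (Fin k → R), w ψ = Ideal.Quotient.mk I (ψ g) := by
  classical
  choose g hg using fun j => Ideal.Quotient.mk_surjective (w (LinearMap.proj j))
  refine ⟨g, fun ψ => ?_⟩
  -- `ψ = ∑ⱼ ψ(eⱼ) • projⱼ`
  have hψ : ψ = ∑ j, ψ (Pi.single j 1) • (LinearMap.proj j : Dual R (Fin k → R)) := by
    apply LinearMap.ext
    intro v
    conv_lhs => rw [← Finset.univ_sum_single v]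
    rw [map_sum, LinearMap.sum_apply]
    refine Finset.sum_congr rfl fun j _ => ?_
    have : (Pi.single j (v j) : Fin k → R) = v j • Pi.single j (1 : R) := by
      ext l
      by_cases h : l = j
      · subst h; simp
      · simp [Pi.single_eq_of_ne h]
    rw [this, map_smul, LinearMap.smul_apply, LinearMap.proj_apply, smul_eq_mul, smul_eq_mul,
      mul_comm]
  have hg' : ψ g = ∑ j, ψ (Pi.single j 1) * g j := by
    conv_lhs => rw [← Finset.univ_sum_single g]
    rw [map_sum]
    refine Finset.sum_congr rfl fun j _ => ?_
    have : (Pi.single j (g j) : Fin k → R) = g j • Pi.single j (1 : R) := by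
      ext l
      by_cases h : l = j
      · subst h; simp
      · simp [Pi.single_eq_of_ne h]
    rw [this, map_smul, smul_eq_mul, mul_comm]
  conv_lhs => rw [hψ]
  rw [map_sum, hg', map_sum]
  refine Finset.sum_congr rfl fun j _ => ?_
  rw [map_smul, ← hg j, map_mul, Algebra.smul_def, Ideal.Quotient.algebraMap_eq]

/-- Regularity on `R` gives regularity on `Rᵏ`: if `x · v ∈ I · Rᵏ` and `x` is a non-zero-divisor on
`R/I`, then `v ∈ I · Rᵏ`. [folklore] -/
theorem mem_ideal_smul_top_of_smul_mem {k : ℕ} (I : Ideal R) {x : R}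
    (hx : IsSMulRegular (R ⧸ I • (⊤ : Submodule R R)) x) {v : Fin k → R}
    (hv : x • v ∈ I • (⊤ : Submodule R (Fin k → R))) : v ∈ I • (⊤ : Submodule R (Fin k → R)) := by
  rw [mem_ideal_smul_top_pi_iff] at hv ⊢
  intro j
  have hj : x * v j ∈ I := by simpa using hv j
  have h0 : (Submodule.Quotient.mk (x * v j) : R ⧸ I • (⊤ : Submodule R R)) = 0 := by
    rw [Submodule.Quotient.mk_eq_zero, smul_eq_mul, Ideal.mul_top]
    exact hj
  have : (Submodule.Quotient.mk (v j) : R ⧸ I • (⊤ : Submodule R R)) = 0 := by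
    refine hx ?_
    change x • (Submodule.Quotient.mk (v j) : R ⧸ I • (⊤ : Submodule R R)) = x • 0
    rw [smul_zero, ← Submodule.Quotient.mk_smul, smul_eq_mul]
    exact h0
  rw [Submodule.Quotient.mk_eq_zero, smul_eq_mul, Ideal.mul_top] at this
  exact this

end Pi

namespace FreeResolution

variable {R : Type u} [CommRing R] {M : Type u} [AddCommGroup M] [Module R M]
variable (F : FreeResolution R M)

/-! ## The `1`-cycle attached to an element of `F₁` -/

/-- For `f ∈ F₁`, the linear map `z_f : F₁^* → R/𝔵`, `φ ↦ φ(f) mod 𝔵` (the image of `f ⊗ 1`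
under `F₁ ⊗ R/𝔵 ≅ Hom(F₁^*, R/𝔵)`). [folklore] -/
def torCycleOf (𝔵 : Ideal R) (f : F.coverObj 1) : F.staircase.G 1 ⟶ ModuleCat.of R (R ⧸ 𝔵) :=
  ModuleCat.ofHom (𝔵.mkQ ∘ₗ Module.Dual.eval R (F.coverObj 1) f)

/-- `z_f(φ) = φ(f) mod 𝔵`. [folklore] -/
theorem torCycleOf_apply (𝔵 : Ideal R) (f : F.coverObj 1) (φ : Dual R (F.coverObj 1)) :
    (F.torCycleOf 𝔵 f).hom φ = Ideal.Quotient.mk 𝔵 (φ f) := rfl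

/-- `z_f` is a cycle (vanishes on `B¹`) when `d₁ f ∈ 𝔵 F₀`. [folklore] -/
theorem i_ι_torCycleOf (𝔵 : Ideal R) (f : F.coverObj 1)
    (hf : (F.syzygyι 0).hom ((F.coverπ 1).hom f) ∈ 𝔵 • (⊤ : Submodule R (F.coverObj 0))) :
    F.staircase.i 1 ≫ F.staircase.ι 1 ≫ F.torCycleOf 𝔵 f = 0 := by
  ext β
  change Ideal.Quotient.mk 𝔵 ((F.dualInflate 1 β.1) f) = 0
  obtain ⟨φ, hφ⟩ := (F.mem_BSub_succ_iff 0 _).mp β.2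
  rw [dualInflate_apply, ← hφ, dualRestrict_apply, Ideal.Quotient.eq_zero_iff_mem]
  exact dual_apply_mem_of_mem_ideal_smul_top 𝔵 hf φ

/-! ## `𝔞 1 ⋯ 𝔞 n` kills `Tor₁(R/𝔵, M)` -/

/-- **The product of the staircase ideals kills `Tor₁(R/𝔵, M) = (K₁ ∩ 𝔵F₀)/𝔵K₁`**: under the
staircase hypothesis for `Q = R/𝔵` (for each `q ≥ 1` either `𝔞 q · E^q = 0` or
`Ext^{q-1}(E^q, R/𝔵) = 0`) and with `B^q` projective for `q > n` (`n ≥ 2`; e.g. `pd M ≤ n`), every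
`c ∈ 𝔞 1 ⋯ 𝔞 n` multiplies every first syzygy `y ∈ K₁` with `j₀(y) ∈ 𝔵F₀` into `𝔵K₁`. This is
[BrunsHerzog1998, Thm. 8.1.2] for `H₁(F ⊗ R/𝔵)`, in the Ext-annihilator form proved by the
staircase lemma. [cite: BrunsHerzog1998, Thm. 8.1.2] -/
theorem smul_mem_smul_top_syzygy_of_mem (𝔵 : Ideal R) (𝔞 : ℕ → Ideal R) (n : ℕ) (hn : 2 ≤ n)
    (h : ∀ q d : ℕ, 1 ≤ q → d + 1 = q →
      (∀ a ∈ 𝔞 q, ∀ e : F.staircase.E q, a • e = 0) ∨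
        (∀ x : Ext.{u} (F.staircase.E q) (ModuleCat.of R (R ⧸ 𝔵)) d, x = 0))
    (hB : ∀ q, n < q → Projective (F.staircase.B q))
    {c : R} (hc : c ∈ ∏ t ∈ Finset.Ico 1 (n + 1), 𝔞 t)
    (y : F.syzygyObj 1) (hy : (F.syzygyι 0).hom y ∈ 𝔵 • (⊤ : Submodule R (F.coverObj 0))) :
    c • y ∈ 𝔵 • (⊤ : Submodule R (F.syzygyObj 1)) := by
  -- write `y = π₁ f`
  obtain ⟨f, rfl⟩ := F.coverπ_surjective 1 y
  -- the staircase lemma applied to the cycle `z_f`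
  obtain ⟨w, hw⟩ := F.staircase.exists_factor_of_mem_prod h hn hB (F.torCycleOf 𝔵 f)
    (F.i_ι_torCycleOf 𝔵 f hy) c hc
  -- represent `w : F₂^* → R/𝔵` by an element `g ∈ F₂`
  obtain ⟨g, hg⟩ := exists_dual_to_quotient_repr 𝔵 w.hom
  -- compare both sides of `hw` on a linear form `φ ∈ F₁^*`
  set d₂ : F.coverObj 2 →ₗ[R] F.coverObj 1 := (F.syzygyι 1).hom ∘ₗ (F.coverπ 2).hom with hd₂
  have key : ∀ φ : Dual R (F.coverObj 1), φ (c • f - d₂ g) ∈ 𝔵 := by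
    intro φ
    have h1 := congrArg (fun k => (ModuleCat.Hom.hom k) φ) hw
    have h3 : Ideal.Quotient.mk 𝔵 (φ (c • f)) = Ideal.Quotient.mk 𝔵 (φ (d₂ g)) :=
      calc Ideal.Quotient.mk 𝔵 (φ (c • f)) = c • Ideal.Quotient.mk 𝔵 (φ f) := by
            rw [map_smul, smul_eq_mul, map_mul, Algebra.smul_def, Ideal.Quotient.algebraMap_eq]
        _ = (ModuleCat.Hom.hom (c • F.torCycleOf 𝔵 f)) φ := rfl
        _ = (ModuleCat.Hom.hom (F.staircase.ρ 1 ≫ F.staircase.i 2 ≫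
              F.staircase.ι 2 ≫ w)) φ := h1
        _ = w.hom (φ ∘ₗ d₂) := rfl
        _ = Ideal.Quotient.mk 𝔵 ((φ ∘ₗ d₂) g) := hg _
        _ = Ideal.Quotient.mk 𝔵 (φ (d₂ g)) := rfl
    rw [map_sub, ← Ideal.Quotient.eq]
    exact h3
  have hmem : c • f - d₂ g ∈ 𝔵 • (⊤ : Submodule R (F.coverObj 1)) :=
    mem_ideal_smul_top_of_forall_dual 𝔵 key
  -- apply `π₁`: `π₁ d₂ = 0` and `π₁(𝔵F₁) ⊆ 𝔵K₁`
  have hsplit : c • (F.coverπ 1).hom f =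
      (F.coverπ 1).hom (d₂ g) + (F.coverπ 1).hom (c • f - d₂ g) := by
    rw [← map_add, add_sub_cancel, map_smul]
  rw [hsplit]
  refine Submodule.add_mem _ ?_ ?_
  · rw [hd₂, LinearMap.comp_apply, coverπ_syzygyι_apply]
    exact Submodule.zero_mem _
  · have := Submodule.mem_map_of_mem (f := (F.coverπ 1).hom) hmem
    rw [Submodule.map_smul''] at this
    exact Submodule.smul_mono le_rfl le_top this

/-! ## The colon statement -/

open Ideal in
/-- **Annihilation of parameter colon modules** (the mechanism of [BrunsHerzog1998, Cor. 8.1.3 (b)]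
and [Schenzel1982, Satz 2.4.2], Ext-annihilator form): let `x = [x₁, …, x_s]` be weakly regular on
`R`, `i < s`, `𝔵 = (x₁, …, x_{i+1})`, and assume the staircase hypothesis for `Q = R/𝔵` and that
`B^q` is projective for `q > n ≥ 2`. Then every `c ∈ 𝔞 1 ⋯ 𝔞 n` satisfies
`c · ((x₁,…,xᵢ)M :_M x_{i+1}) ⊆ (x₁,…,xᵢ)M`: if `x_{i+1} m ∈ (x₁,…,xᵢ)M` then
`c m ∈ (x₁,…,xᵢ)M`. Proof: lift `m` to `F₀`; `x_{i+1} m̃ - u` (`u ∈ (x₁,…,xᵢ)F₀` lifting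
`x_{i+1} m`) is a first syzygy lying in `𝔵F₀`, so `c` times it lies in
`𝔵K₁ = (x₁,…,xᵢ)K₁ + x_{i+1}K₁` (`smul_mem_smul_top_syzygy_of_mem`); regularity of `x_{i+1}` on
`F₀/(x₁,…,xᵢ)F₀` then puts `c m̃` into `(x₁,…,xᵢ)F₀ + K₁`.
[cite: BrunsHerzog1998, Cor. 8.1.3 (b); Schenzel1982, Satz 2.4.2] -/
theorem smul_mem_of_getElem_smul_mem (rs : List R) (hreg : IsWeaklyRegular R rs)
    {i : ℕ} (hi : i < rs.length) (𝔞 : ℕ → Ideal R) (n : ℕ) (hn : 2 ≤ n)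
    (h : ∀ q d : ℕ, 1 ≤ q → d + 1 = q →
      (∀ a ∈ 𝔞 q, ∀ e : F.staircase.E q, a • e = 0) ∨
        (∀ x : Ext.{u} (F.staircase.E q)
          (ModuleCat.of R (R ⧸ ofList (rs.take (i + 1)))) d, x = 0))
    (hB : ∀ q, n < q → Projective (F.staircase.B q))
    {c : R} (hc : c ∈ ∏ t ∈ Finset.Ico 1 (n + 1), 𝔞 t)
    {m : M} (hm : rs[i] • m ∈ (ofList (rs.take i) • ⊤ : Submodule R M)) :
    c • m ∈ (ofList (rs.take i) • ⊤ : Submodule R M) := by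
  set 𝔵 : Ideal R := ofList (rs.take (i + 1)) with h𝔵
  have h𝔵' : 𝔵 = ofList (rs.take i) ⊔ Ideal.span {rs[i]} := by
    rw [h𝔵, List.take_succ_eq_append_getElem hi, ofList_append, ofList_singleton]
  have hle : ofList (rs.take i) ≤ 𝔵 := by rw [h𝔵']; exact le_sup_left
  have hxmem : rs[i] ∈ 𝔵 := by rw [h𝔵']; exact Ideal.mem_sup_right (Ideal.mem_span_singleton_self _)
  -- regularity of `rs[i]` on `R/(x₁,…,xᵢ)`
  have hregi : IsSMulRegular (R ⧸ ofList (rs.take i) • (⊤ : Submodule R R)) rs[i] :=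
    hreg.regular_mod_prev i hi
  -- the cover `π₀ : F₀ → M` (`K₀ = M`)
  let π₀ : F.coverObj 0 →ₗ[R] M := (F.coverπ 0).hom
  have hπ₀ : Function.Surjective π₀ := F.coverπ_surjective 0
  obtain ⟨mt, hmt⟩ := hπ₀ m
  -- lift `rs[i] • m ∈ (x₁,…,xᵢ)M` to `u ∈ (x₁,…,xᵢ)F₀`
  have hm' : rs[i] • m ∈ Submodule.map π₀ (ofList (rs.take i) • (⊤ : Submodule R (F.coverObj 0))) := by
    rw [Submodule.map_smul'', Submodule.map_top, LinearMap.range_eq_top.mpr hπ₀]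
    exact hm
  obtain ⟨u, hu, huπ⟩ := hm'
  -- the first syzygy `y' = rs[i] • m̃ - u`
  have hy' : π₀ (rs[i] • mt - u) = 0 := by
    rw [map_sub, map_smul, hmt, huπ, sub_self]
  set y : F.syzygyObj 1 := (F.syzygySuccEquiv 0).symm ⟨rs[i] • mt - u, (F.coverπ_apply_eq_zero_iff 0 _).mp hy'⟩ with hy
  have hyι : (F.syzygyι 0).hom y = rs[i] • mt - u := rfl
  have hy𝔵 : (F.syzygyι 0).hom y ∈ 𝔵 • (⊤ : Submodule R (F.coverObj 0)) := by
    rw [hyι]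
    refine Submodule.sub_mem _ (Submodule.smul_mem_smul hxmem Submodule.mem_top) ?_
    exact Submodule.smul_mono_left hle hu
  -- `c • y ∈ 𝔵 K₁`
  have hcy := F.smul_mem_smul_top_syzygy_of_mem 𝔵 𝔞 n hn h hB hc y hy𝔵
  -- push into `F₀`: `c • (rs[i] • m̃ - u) ∈ (x₁,…,xᵢ)K₁ + rs[i] • K₁`
  have hcy' : c • (rs[i] • mt - u) ∈
      𝔵 • (LinearMap.ker π₀ : Submodule R (F.coverObj 0)) := by
    have := Submodule.mem_map_of_mem (f := (F.syzygyι 0).hom) hcy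
    rw [Submodule.map_smul'', Submodule.map_top, range_syzygyι, map_smul, hyι] at this
    exact this
  rw [h𝔵', Submodule.sup_smul, Submodule.ideal_span_singleton_smul, Submodule.mem_sup] at hcy'
  obtain ⟨w, hw, z, hz, hwz⟩ := hcy'
  obtain ⟨nn, hnn, rfl⟩ := (Submodule.mem_smul_pointwise_iff_exists z rs[i] _).mp hz
  -- `rs[i] • (c • m̃ - n) = w + c • u ∈ (x₁,…,xᵢ)F₀`
  have hkey : rs[i] • (c • mt - nn) ∈ ofList (rs.take i) • (⊤ : Submodule R (F.coverObj 0)) := by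
    have e : rs[i] • (c • mt - nn) = w + c • u := by
      rw [smul_sub, smul_comm, ← sub_eq_iff_eq_add.mpr hwz.symm, smul_sub]
      abel
    rw [e]
    exact Submodule.add_mem _ (Submodule.smul_mono le_rfl le_top hw) (Submodule.smul_mem _ c hu)
  have hkey' : c • mt - nn ∈ ofList (rs.take i) • (⊤ : Submodule R (F.coverObj 0)) :=
    mem_ideal_smul_top_of_smul_mem (ofList (rs.take i)) hregi hkey
  -- apply `π₀`
  have := Submodule.mem_map_of_mem (f := π₀) hkey'
  rw [Submodule.map_smul'', Submodule.map_top, LinearMap.range_eq_top.mpr hπ₀, map_sub, map_smul,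
    hmt, LinearMap.mem_ker.mp hnn, sub_zero] at this
  exact this

end FreeResolution

end Literature.AlgebraicGeometry.Resolution

end
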